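import Summits.HodgeConjecture.HodgeConjecture.Theorems.F0LD2ThetaTorusEigenclass
import Summits.HodgeConjecture.HodgeConjecture.Theorems.F0LD2PinnedArchSingleTransport
import Literature.NumberTheory.Automorphic.ArchDiagonalTorus
import Literature.RepresentationTheory.CompactGroups.CharProjEigenvector
import HarnessLib

/-!
# (Gβ2-ii-α) The archimedean torus hom `T_∞ = ∏_{v real} (S¹)^N →* U(H)(𝔸)` through the pinned transport, and the FULL-torus
# eigen-identity ∕ character projectors on Hermite theta classes (line LD1 of crux HLiu418, organ (Gβ) «theta slice», LD1-plan (g2) DEALS #5 (2))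

Cell hodgecm-mathlib, floor 0; namespace `Summit.HodgeConjecture.HodgeConjecture.Cruxes.HLiu418.F0LD1ArchTorusHom`; seat LD1-p02 (g3);
`--supports stmt-HodgeConjecture-24832 --as helper`.  THEOREMS ONLY (no definition, no instance, no notation, no `sorry`).

§1 (the hom, ∃-packaged so that no `def` enters a proof file).  Under the letters' PIN of the abstract transport `ιA : U(H)(𝔸_{L⁺}) →* U(diag dV)(𝔸_{L⁺})`
(`↑(ιA k) = g_𝔸⁻¹ · k · g_𝔸`, scaled frame `ᵗ(c̄ g) (t • H) g = diag dV`, `t ≠ 0`; ★ `F0LD2FrameTransportPin`) there is a CONTINUOUS monoid hom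
`k : T_∞ →* U(H)(𝔸)`, `T_∞ := ({v : InfinitePlace L⁺ // v real} → Fin N → Circle)` (compact commutative), with, for every real place `v` and `x ∈ (S¹)^N`,
`ιA (k (mulSingle v x)) = adelicSingle_{diag dV} (cmPlaceOver L v) diag(x)` — EXACTLY the `hk` shape of ★
`F0LD2ThetaTorusEigenclass.rightRegular_toLp_lineThetaLift_follandHermite_of_eq_adelicSingle` and of ★ (Gβ2-ii-γ) `F0LD1ThetaClassTorusCharProj` — and with
trivial finite part and `cmPlaceOver L v`-component `diag(z_v)` for every `z ∈ T_∞` (`exists_continuous_archTorusHom`).  Construction: `k = ιA⁻¹ ∘ archToAdelic ∘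
archDiagTorus ∘ (re-index real ↦ complex places)` with `ιA⁻¹ = (U(t•H)(𝔸) = U(H)(𝔸)) ∘ cmAdelicEquiv ∘ (cmFrameEquiv g (t•H) dV)⁻¹` (★ `ThetaLiftFromLineFrame`, ★
`UnitaryDualPairThetaKernelCM`, ★ `ArchDiagonalTorus`); the one-place reading is ★ `F0LD2PinnedArchSingleTransport` §1.
§2 (γ∞) For ANY hom `k` with that `mulSingle` pin, the Hermite theta class `[θ_{h_β ⊗ Φ_f}]` is a `k`-EIGENVECTOR of the FULL torus with character
`c(z) = ∏_v ∏_p z_{v,p}^{n_{v,p}(β)}` (`rightRegular_apply_thetaClass_follandHermite_of_torusPin`: induction over the real places on `z = ∏_v mulSingle v z_v`, the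
one-place ★ eigen-identity at each step, `R` a hom); §3 hence `Schur.charProj μT κ ((rightRegular ν).restrict k)` FIXES the class when `κ = c` and KILLS it when
`κ ≇ σ = c` (★ p850551).  Why the full torus: the exponents `n_{v,p}(β)` over ALL `(v, p)` determine `β` (the junction's «a weight pins ONE Hermite line»);
one place pins only the `v₀`-column of `β`.  Nothing printed is discharged.
HC_CM is proved only modulo the 7 printed citations (2 remaining: hLiu418 = stmt-HodgeConjecture-24832, h413 = stmt-HodgeConjecture-24833) until rung 0 closes.

References (prose locators): Borel–Jacquet 1979 §4.1 (`G(𝔸) = G_∞ × G(𝔸_f)`, `G_∞ = ∏_v G(F_v)`), §4.6; Bröcker–tom Dieck 1985 IV (3.1) (diagonal torus),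
III (5.10) (character projectors); Konno–Konno 2007 Thm 5.4 (torus action on Hermite functions); Platonov–Rapinchuk 1994 §2.3.
-/

set_option autoImplicit false
set_option linter.dupNamespace false

noncomputable section

open NumberField NumberField.InfinitePlace MeasureTheory IsDedekindDomain
open scoped Matrix ComplexOrder ENNReal TensorProduct SchwartzMap Kronecker Classical ComplexConjugate InnerProductSpace

namespace Summit.HodgeConjecture.HodgeConjecture.Cruxes.HLiu418.F0LD1ArchTorusHom

open _root_.MeasureTheory
open Literature.NumberTheory.Automorphic Literature.NumberTheory.Automorphic.UnitaryGroup
open Literature.NumberTheory.Automorphic.UnitaryGroup.CotangentForms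
open Literature.NumberTheory.Automorphic.IdeleClassGroup
open Literature.NumberTheory.Automorphic.Liu2021
open Literature.NumberTheory.Automorphic.Liu2021.Def411WeilCarriers
open Literature.NumberTheory.Automorphic.Liu2021.Def411WeilCarriersDoubling
open Literature.NumberTheory.Automorphic.Liu2021.CinfThetaTorus
open Literature.NumberTheory.GelbartRogawski1991 Literature.NumberTheory.GelbartRogawski1991.UnitaryDualPair
open Literature.NumberTheory.GelbartRogawski1991.GRConstruction
open Literature.NumberTheory.Weil1964
open Literature.RepresentationTheory.Liu2021
open Literature.RepresentationTheory.HeisenbergGroup Literature.Analysis.SegalBargmann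
open Literature.RepresentationTheory.KonnoKonno2007 Literature.RepresentationTheory.KonnoKonno2007.RealDualPair
open Literature.RepresentationTheory.CompactGroups
open Summit.HodgeConjecture.HodgeConjecture.Cruxes.HLiu418.F0LD1ThetaTransportKit
open Summit.HodgeConjecture.HodgeConjecture.Cruxes.HLiu418.F0LD2ThetaTensorClasses
open Summit.HodgeConjecture.HodgeConjecture.Cruxes.HLiu418.F0LD2ThetaTorusEigenclass


variable (L : Type) [Field L] [NumberField L] [IsCMField L] (N : ℕ) (H : Matrix (Fin N) (Fin N) L)
  {n' : ℕ} (e₁ : Fin N × Fin 1 ≃ Fin n') (dV : Fin N → L) (hdV : ∀ i, IsCMField.complexConj L (dV i) = dV i)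
open Summit.HodgeConjecture.HodgeConjecture.Cruxes.HLiu418.F0LD2ArchAdmissibleAssembly (frame_smul_eq)
open Summit.HodgeConjecture.HodgeConjecture.Cruxes.HLiu418.F0LD2FrameTransportPin (adelic_smul_eq pin_apply)
open Summit.HodgeConjecture.HodgeConjecture.Cruxes.HLiu418.F0LD2PinnedArchSingleTransport (eq_adelicSingle_of_finPart_eq_one_of_archAt_eq_one)

/-! ## §1 The archimedean torus hom through the pinned transport -/

section Torus

variable (L : Type) [Field L] [NumberField L] [IsCMField L] (N : ℕ) (H : Matrix (Fin N) (Fin N) L) (dV : Fin N → L)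
  (t : L) (ht : t ≠ 0) (g : GL (Fin N) L)
  (hg : formCongr ((IsCMField.complexConj L : L ≃ₐ[↥(maximalRealSubfield L)] L) : L →+* L) g (t • H) = Matrix.diagonal dV)
  (ιA : (adelicGroupData (↥(maximalRealSubfield L)) L (IsCMField.complexConj L) N H).Adelic →*
    ↥(UnitaryGroup.adelic (↥(maximalRealSubfield L)) L (IsCMField.complexConj L) N (Matrix.diagonal dV)))
  (hpin : ∀ k, ((ιA k : ↥(UnitaryGroup.adelic (↥(maximalRealSubfield L)) L (IsCMField.complexConj L) N (Matrix.diagonal dV))) :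
      GL (Fin N) (AdeleRing (𝓞 L) L)) =
    (toAdeleGL L g)⁻¹ * adelicVal (↥(maximalRealSubfield L)) L (IsCMField.complexConj L) N H k * toAdeleGL L g)

include ht hg hpin in
/-- **(Gβ2-ii-α) THE ARCHIMEDEAN TORUS HOM.**  Under the pin of `ιA` there is a continuous hom `k : (∏_{v real} (S¹)^N) →* U(H)(𝔸_{L⁺})` whose transport is the
diagonal archimedean torus of `U(diag dV)`: for every real place `v` of `L⁺` and `x ∈ (S¹)^N`, `ιA (k (mulSingle v x)) = adelicSingle (cmPlaceOver L v) diag(x)`;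
for every `z`, `ιA (k z)` has trivial finite part and `cmPlaceOver L v`-component `diag(z_v)` (`k = ιA⁻¹ ∘ archToAdelic ∘ archDiagTorus ∘ re-index`, ★
`cmFrameEquiv`∕`cmAdelicEquiv`∕`archDiagTorus`; `G(𝔸) = G_∞ × G(𝔸_f)`, `G_∞ = ∏_w G(L⁺_w)`). [cite: BorelJacquet1979, §4.1] [cite: BrockerTomDieck1985, IV (3.1)]
[cite: PlatonovRapinchuk1994, §2.3] -/
theorem exists_continuous_archTorusHom :
    ∃ k : (({v : InfinitePlace (↥(maximalRealSubfield L)) // v.IsReal}) → Fin N → Circle) →*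
        (adelicGroupData (↥(maximalRealSubfield L)) L (IsCMField.complexConj L) N H).Adelic,
      Continuous k ∧
      (∀ (v : {v : InfinitePlace (↥(maximalRealSubfield L)) // v.IsReal}) (x : Fin N → Circle),
        ιA (k (Pi.mulSingle v x)) = UnitaryGroup.adelicSingle (↥(maximalRealSubfield L)) L (IsCMField.complexConj L) N (Matrix.diagonal dV)
          (IsCMField.complexConj_ne_one L) (complexConj_smul_infinitePlace L) (cmPlaceOver L v)
          ⟨circleDiagonal N x, circleDiagonal_mem_archLocal_diagonal L N dV (cmPlaceOver L v) x⟩) ∧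
      (∀ z, finPart (↥(maximalRealSubfield L)) L (IsCMField.complexConj L) N (Matrix.diagonal dV) (ιA (k z)) = 1) ∧
      ∀ z (v : {v : InfinitePlace (↥(maximalRealSubfield L)) // v.IsReal}),
        ((archAt (↥(maximalRealSubfield L)) L (IsCMField.complexConj L) N (Matrix.diagonal dV) (cmPlaceOver L v)
            (complexConj_smul_infinitePlace L (cmPlaceOver L v).1) (IsCMField.complexConj_ne_one L)
            (archPart (↥(maximalRealSubfield L)) L (IsCMField.complexConj L) N (Matrix.diagonal dV) (ιA (k z))) :
            UnitaryGroup.archLocal L N (Matrix.diagonal dV) (cmPlaceOver L v)) : GL (Fin N) ℂ) = circleDiagonal N (z v) := by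
  -- the real place under a complex place (all places of `L⁺` are real, all places of `L` complex), and the re-indexing of the torus
  let under : {w : InfinitePlace L // w.IsComplex} → {v : InfinitePlace (↥(maximalRealSubfield L)) // v.IsReal} := fun w =>
    ⟨w.1.comap (algebraMap (↥(maximalRealSubfield L)) L), IsTotallyReal.isReal _⟩
  have hunder : ∀ v : {v : InfinitePlace (↥(maximalRealSubfield L)) // v.IsReal}, under (cmPlaceOver L v) = v := fun v =>
    Subtype.ext (cmPlaceOver_comap L v)
  have hunder' : ∀ (w : {w : InfinitePlace L // w.IsComplex}) (v : {v : InfinitePlace (↥(maximalRealSubfield L)) // v.IsReal}),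
      under w = v → w = cmPlaceOver L v := fun w v h => by
    apply Subtype.ext
    apply (IsCMField.equivInfinitePlace L).injective
    rw [IsCMField.equivInfinitePlace_apply, IsCMField.equivInfinitePlace_apply, cmPlaceOver_comap]
    exact congrArg Subtype.val h
  let re : (({v : InfinitePlace (↥(maximalRealSubfield L)) // v.IsReal}) → Fin N → Circle) →*
      (({w : InfinitePlace L // w.IsComplex}) → Fin N → Circle) :=
    MonoidHom.pi fun w => Pi.evalMonoidHom (fun _ : {v : InfinitePlace (↥(maximalRealSubfield L)) // v.IsReal} => Fin N → Circle) (under w)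
  have hg' := frame_smul_eq L N H dV t g hg
  -- the inverse transport `U(diag dV)(𝔸) →* U(H)(𝔸)`
  let ιinv : ↥(UnitaryGroup.adelic (↥(maximalRealSubfield L)) L (IsCMField.complexConj L) N (Matrix.diagonal dV)) →*
      (adelicGroupData (↥(maximalRealSubfield L)) L (IsCMField.complexConj L) N H).Adelic :=
    (Subgroup.inclusion (adelic_smul_eq L N H t ht).le).comp
      ((cmAdelicEquiv L N (t • H)).toMulEquiv.toMonoidHom.comp (cmFrameEquiv L g (t • H) dV hg').symm.toMulEquiv.toMonoidHom)
  have hιinv : ∀ y, ιA (ιinv y) = y := fun y => by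
    have hm := coe_cmFrameEquiv L g (t • H) dV hg' ((cmFrameEquiv L g (t • H) dV hg').symm y)
    rw [ContinuousMulEquiv.apply_symm_apply] at hm
    apply Subtype.ext
    rw [hpin, hm]
    rfl
  let k : (({v : InfinitePlace (↥(maximalRealSubfield L)) // v.IsReal}) → Fin N → Circle) →*
      (adelicGroupData (↥(maximalRealSubfield L)) L (IsCMField.complexConj L) N H).Adelic :=
    ιinv.comp ((archToAdelic (↥(maximalRealSubfield L)) L (IsCMField.complexConj L) N (Matrix.diagonal dV)).comp
      ((archDiagTorus L N dV).comp re))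
  have hk : ∀ z, ιA (k z) = archToAdelic (↥(maximalRealSubfield L)) L (IsCMField.complexConj L) N (Matrix.diagonal dV)
      (archDiagTorus L N dV (re z)) := fun z => hιinv _
  have hcomp : ∀ z (w : {w : InfinitePlace L // w.IsComplex}),
      ((archAt (↥(maximalRealSubfield L)) L (IsCMField.complexConj L) N (Matrix.diagonal dV) w
          (complexConj_smul_infinitePlace L w.1) (IsCMField.complexConj_ne_one L)
          (archPart (↥(maximalRealSubfield L)) L (IsCMField.complexConj L) N (Matrix.diagonal dV) (ιA (k z))) :
          UnitaryGroup.archLocal L N (Matrix.diagonal dV) w) : GL (Fin N) ℂ) = circleDiagonal N (z (under w)) := fun z w => by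
    rw [hk, archPart_archToAdelic, archAt_archDiagTorus]
    rfl
  refine ⟨k, ?_, fun v x => ?_, fun z => ?_, fun z v => ?_⟩
  · -- continuity: a composite of continuous maps
    exact (Continuous.subtype_mk continuous_subtype_val _).comp <| (cmAdelicEquiv L N (t • H)).continuous.comp <|
      (cmFrameEquiv L g (t • H) dV hg').symm.continuous.comp <|
      (continuous_archToAdelic (↥(maximalRealSubfield L)) L (IsCMField.complexConj L) N (Matrix.diagonal dV)).comp <|
      (continuous_archDiagTorus L N dV).comp <| continuous_pi fun w => continuous_apply (under w)
  · -- one coordinate: trivial finite part, `w`-components `diag((mulSingle v x) (under w))` = `diag x` at `cmPlaceOver L v`, `1` elsewhere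
    have hfin : finPart (↥(maximalRealSubfield L)) L (IsCMField.complexConj L) N (Matrix.diagonal dV) (ιA (k (Pi.mulSingle v x))) = 1 := by
      rw [hk, finPart_archToAdelic]
    have haway : ∀ w : {w : InfinitePlace L // w.IsComplex}, w ≠ cmPlaceOver L v →
        archAt (↥(maximalRealSubfield L)) L (IsCMField.complexConj L) N (Matrix.diagonal dV) w (complexConj_smul_infinitePlace L w.1)
          (IsCMField.complexConj_ne_one L)
          (archPart (↥(maximalRealSubfield L)) L (IsCMField.complexConj L) N (Matrix.diagonal dV) (ιA (k (Pi.mulSingle v x)))) = 1 := by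
      intro w hw
      have hne : under w ≠ v := fun h => hw (hunder' w v h)
      apply Subtype.ext
      rw [hcomp, OneMemClass.coe_one, Pi.mulSingle_eq_of_ne hne, map_one]
    rw [eq_adelicSingle_of_finPart_eq_one_of_archAt_eq_one (↥(maximalRealSubfield L)) L (IsCMField.complexConj L) N (Matrix.diagonal dV)
      (IsCMField.complexConj_ne_one L) (complexConj_smul_infinitePlace L) (cmPlaceOver L v) _ hfin haway]
    congr 1
    apply Subtype.ext
    rw [hcomp, hunder, Pi.mulSingle_eq_same]
  · rw [hk, finPart_archToAdelic]
  · rw [hcomp, hunder]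

end Torus

/-! ## §2 The full-torus eigen-identity on Hermite theta classes (any hom with the `mulSingle` pin) -/

section Eigen

/-- `z̄ z = 1` on the circle (Mathlib `Circle.normSq_coe`). [folklore] -/
private theorem star_coe_circle_mul_self (x : Circle) : star ((x : Circle) : ℂ) * (x : ℂ) = 1 := by
  rw [Complex.star_def, ← Complex.normSq_eq_conj_mul_self, Circle.normSq_coe, Complex.ofReal_one]


variable (L : Type) [Field L] [NumberField L] [IsCMField L] (N : ℕ) (H : Matrix (Fin N) (Fin N) L)
  {n' : ℕ} (e₁ : Fin N × Fin 1 ≃ Fin n') (dV : Fin N → L) (hdV : ∀ i, IsCMField.complexConj L (dV i) = dV i)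
  (hdV0 : ∀ i, dV i ≠ 0)
  (ιA : (adelicGroupData (↥(maximalRealSubfield L)) L (IsCMField.complexConj L) N H).Adelic →*
    ↥(UnitaryGroup.adelic (↥(maximalRealSubfield L)) L (IsCMField.complexConj L) N (Matrix.diagonal dV)))
  (hιA : Continuous ιA ∧ ∀ ⦃γ : (adelicGroupData (↥(maximalRealSubfield L)) L (IsCMField.complexConj L) N H).Adelic⦄,
    γ ∈ (UnitaryGroup.toAdelic (↥(maximalRealSubfield L)) L (IsCMField.complexConj L) N H).range →
      ιA γ ∈ (UnitaryGroup.toAdelic (↥(maximalRealSubfield L)) L (IsCMField.complexConj L) N (Matrix.diagonal dV)).range)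
  (μ : Literature.NumberTheory.Automorphic.IdeleClassGroup L →ₜ* Circle) (hμ : IsConjugateSymplectic L μ) (a : (↥(maximalRealSubfield L))ˣ)
  (hρ : HasThetaMajorants fun
      (p : ↥(UnitaryGroup.adelic (↥(maximalRealSubfield L)) L (IsCMField.complexConj L) N (Matrix.diagonal dV)) ×
        ↥(UnitaryGroup.adelic (↥(maximalRealSubfield L)) L (IsCMField.complexConj L) 1 (JW (↥(maximalRealSubfield L)) L a)))
      (Φ : piSchwartzBruhat (↥(maximalRealSubfield L)) (Fin n')) =>
        pairRep (↥(maximalRealSubfield L)) L (IsCMField.complexConj L) N 1 e₁ (Matrix.diagonal dV) (JW (↥(maximalRealSubfield L)) L a)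
          (chiSplittingLine L e₁ dV hdV hdV0 (toHeckeCharacter L μ) (isUnitary_toHeckeCharacter L μ)
            ((isOscillatorChar_toHeckeCharacter_iff μ).mpr hμ) (TW (↥(maximalRealSubfield L)) a)
            (isUnit_det_TW (↥(maximalRealSubfield L)) a) (JW (↥(maximalRealSubfield L)) L a) (JW_eq (↥(maximalRealSubfield L)) L a))
          p Φ)
  [CompactSpace (↥(UnitaryGroup.adelic (↥(maximalRealSubfield L)) L (IsCMField.complexConj L) N (Matrix.diagonal dV)) ⧸
    (UnitaryGroup.toAdelic (↥(maximalRealSubfield L)) L (IsCMField.complexConj L) N (Matrix.diagonal dV)).range)]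
  [MeasurableSpace (↥(UnitaryGroup.adelic (↥(maximalRealSubfield L)) L (IsCMField.complexConj L) 1 (JW (↥(maximalRealSubfield L)) L a)) ⧸
    (UnitaryGroup.toAdelic (↥(maximalRealSubfield L)) L (IsCMField.complexConj L) 1 (JW (↥(maximalRealSubfield L)) L a)).range)]
  (μW : Measure (↥(UnitaryGroup.adelic (↥(maximalRealSubfield L)) L (IsCMField.complexConj L) 1 (JW (↥(maximalRealSubfield L)) L a)) ⧸
    (UnitaryGroup.toAdelic (↥(maximalRealSubfield L)) L (IsCMField.complexConj L) 1 (JW (↥(maximalRealSubfield L)) L a)).range))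
  (f : C((↥(UnitaryGroup.adelic (↥(maximalRealSubfield L)) L (IsCMField.complexConj L) 1 (JW (↥(maximalRealSubfield L)) L a)) ⧸
    (UnitaryGroup.toAdelic (↥(maximalRealSubfield L)) L (IsCMField.complexConj L) 1 (JW (↥(maximalRealSubfield L)) L a)).range), ℂ))
  [BorelSpace (↥(UnitaryGroup.adelic (↥(maximalRealSubfield L)) L (IsCMField.complexConj L) 1 (JW (↥(maximalRealSubfield L)) L a)) ⧸
    (UnitaryGroup.toAdelic (↥(maximalRealSubfield L)) L (IsCMField.complexConj L) 1 (JW (↥(maximalRealSubfield L)) L a)).range)]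
  [IsFiniteMeasure μW]
  [CompactSpace (adelicGroupData (↥(maximalRealSubfield L)) L (IsCMField.complexConj L) N H).automorphicQuotient]
  (ν : Measure (adelicGroupData (↥(maximalRealSubfield L)) L (IsCMField.complexConj L) N H).automorphicQuotient) [IsFiniteMeasure ν]
  [SMulInvariantMeasure (adelicGroupData (↥(maximalRealSubfield L)) L (IsCMField.complexConj L) N H).Adelic
    (adelicGroupData (↥(maximalRealSubfield L)) L (IsCMField.complexConj L) N H).automorphicQuotient ν]

include hιA

set_option maxHeartbeats 400000 in
/-- **§2 (γ∞) THE FULL-TORUS EIGEN-IDENTITY.**  For any hom `k : T_∞ →* U(H)(𝔸)` with `ιA (k (mulSingle v x)) = adelicSingle (cmPlaceOver L v) diag(x)` and every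
`z ∈ T_∞ = ∏_{v real} (S¹)^N`: `R(k z) [θ_{h_β ⊗ Φ_f}] = (∏_v ∏_p z_{v,p}^{n_{v,p}}) • [θ_{h_β ⊗ Φ_f}]`, `n_{v,p} = (τ_{w(v)}+1)∕2 + β(e₁(p,0),v)` on the positive sign
class and `(τ_{w(v)}+1)∕2 − 1 − β(e₁(p,0),v)` on the negative one (induction on `z = ∏_v mulSingle v z_v` over the real places: `k` and `R = rightRegular ν` are homs,
each factor acts by the one-place ★ eigen-identity `rightRegular_toLp_lineThetaLift_follandHermite_of_eq_adelicSingle`). [cite: KonnoKonno2007, Thm. 5.4]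
[cite: BorelJacquet1979, §4.1, §4.6] -/
theorem rightRegular_apply_thetaClass_follandHermite_of_torusPin
    {τ : InfinitePlace L → ℤ} (hτ : (toHeckeCharacter L μ).HasUnitaryArchType τ 0) (hodd : ∀ w, Odd (τ w))
    (β : (Fin n' × {v : InfinitePlace (↥(maximalRealSubfield L)) // v.IsReal}) →₀ ℕ) (Φf : FinSB (↥(maximalRealSubfield L)) (Fin n'))
    (k : (({v : InfinitePlace (↥(maximalRealSubfield L)) // v.IsReal}) → Fin N → Circle) →*
      (adelicGroupData (↥(maximalRealSubfield L)) L (IsCMField.complexConj L) N H).Adelic)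
    (hk : ∀ (v : {v : InfinitePlace (↥(maximalRealSubfield L)) // v.IsReal}) (x : Fin N → Circle),
      ιA (k (Pi.mulSingle v x)) = UnitaryGroup.adelicSingle (↥(maximalRealSubfield L)) L (IsCMField.complexConj L) N (Matrix.diagonal dV)
        (IsCMField.complexConj_ne_one L) (complexConj_smul_infinitePlace L) (cmPlaceOver L v)
        ⟨circleDiagonal N x, circleDiagonal_mem_archLocal_diagonal L N dV (cmPlaceOver L v) x⟩)
    (z : ({v : InfinitePlace (↥(maximalRealSubfield L)) // v.IsReal}) → Fin N → Circle) :
    (adelicGroupData (↥(maximalRealSubfield L)) L (IsCMField.complexConj L) N H).rightRegular ν (k z)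
        (MemLp.toLp _ (memLp_toQuotFun_lineThetaLift L N H e₁ dV hdV hdV0 ιA hιA μ hμ a hρ μW
          (piSchwartzBruhatEquiv (↥(maximalRealSubfield L)) (Fin n')
            (follandHermite (frameV L e₁ dV hdV hdV0 (lineW L (TW (Fp L) a)) (complexConj_lineW L (TW (Fp L) a))
              (lineW_ne_zero L (TW (Fp L) a) (isUnit_det_TW (Fp L) a))) β ⊗ₜ Φf)) f ν 2)) =
      (∏ v : {v : InfinitePlace (↥(maximalRealSubfield L)) // v.IsReal}, ∏ p : Fin N, (((z v p : Circle) : ℂ)) ^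
        (if 0 < signVec (cmPlaceOver L) (cmGramEntry L e₁ dV hdV (lineW L (TW (Fp L) a)) (complexConj_lineW L (TW (Fp L) a))) (imagUnit L) v (e₁ (p, 0))
          then (τ (cmPlaceOver L v).1 + 1) / 2 + β (e₁ (p, 0), v)
          else (τ (cmPlaceOver L v).1 + 1) / 2 - 1 - β (e₁ (p, 0), v))) •
        (MemLp.toLp _ (memLp_toQuotFun_lineThetaLift L N H e₁ dV hdV hdV0 ιA hιA μ hμ a hρ μW
          (piSchwartzBruhatEquiv (↥(maximalRealSubfield L)) (Fin n')
            (follandHermite (frameV L e₁ dV hdV hdV0 (lineW L (TW (Fp L) a)) (complexConj_lineW L (TW (Fp L) a))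
              (lineW_ne_zero L (TW (Fp L) a) (isUnit_det_TW (Fp L) a))) β ⊗ₜ Φf)) f ν 2)) := by
  set θ := (MemLp.toLp _ (memLp_toQuotFun_lineThetaLift L N H e₁ dV hdV hdV0 ιA hιA μ hμ a hρ μW
          (piSchwartzBruhatEquiv (↥(maximalRealSubfield L)) (Fin n')
            (follandHermite (frameV L e₁ dV hdV hdV0 (lineW L (TW (Fp L) a)) (complexConj_lineW L (TW (Fp L) a))
              (lineW_ne_zero L (TW (Fp L) a) (isUnit_det_TW (Fp L) a))) β ⊗ₜ Φf)) f ν 2)) with hθ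
  -- one coordinate
  have hone : ∀ (v : {v : InfinitePlace (↥(maximalRealSubfield L)) // v.IsReal}) (x : Fin N → Circle),
      (adelicGroupData (↥(maximalRealSubfield L)) L (IsCMField.complexConj L) N H).rightRegular ν (k (Pi.mulSingle v x)) θ =
        (∏ p : Fin N, (((x p : Circle) : ℂ)) ^
          (if 0 < signVec (cmPlaceOver L) (cmGramEntry L e₁ dV hdV (lineW L (TW (Fp L) a)) (complexConj_lineW L (TW (Fp L) a))) (imagUnit L) v (e₁ (p, 0))
            then (τ (cmPlaceOver L v).1 + 1) / 2 + β (e₁ (p, 0), v)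
            else (τ (cmPlaceOver L v).1 + 1) / 2 - 1 - β (e₁ (p, 0), v))) • θ := fun v x => by
    have h := rightRegular_toLp_lineThetaLift_follandHermite_of_eq_adelicSingle L N H e₁ dV hdV hdV0 ιA hιA μ hμ a hρ μW f ν v hτ hodd
      (fun p => ((x p : Circle) : ℂ)) (fun p => star_coe_circle_mul_self (x p))
      ⟨circleDiagonal N x, circleDiagonal_mem_archLocal_diagonal L N dV (cmPlaceOver L v) x⟩ (coe_circleDiagonal N x)
      (k (Pi.mulSingle v x)) (hk v x) β Φf
    rw [← hθ] at h
    exact h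
  -- induction over finite sets of real places
  have key : ∀ S : Finset {v : InfinitePlace (↥(maximalRealSubfield L)) // v.IsReal},
      (adelicGroupData (↥(maximalRealSubfield L)) L (IsCMField.complexConj L) N H).rightRegular ν (k (∏ v ∈ S, Pi.mulSingle v (z v))) θ =
        (∏ v ∈ S, ∏ p : Fin N, (((z v p : Circle) : ℂ)) ^
          (if 0 < signVec (cmPlaceOver L) (cmGramEntry L e₁ dV hdV (lineW L (TW (Fp L) a)) (complexConj_lineW L (TW (Fp L) a))) (imagUnit L) v (e₁ (p, 0))
            then (τ (cmPlaceOver L v).1 + 1) / 2 + β (e₁ (p, 0), v)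
            else (τ (cmPlaceOver L v).1 + 1) / 2 - 1 - β (e₁ (p, 0), v))) • θ := by
    intro S
    induction S using Finset.induction_on with
    | empty => rw [Finset.prod_empty, Finset.prod_empty, map_one, map_one, one_apply_eq_self, one_smul]
    | insert v₁ S hv₁ ih =>
      rw [Finset.prod_insert hv₁, Finset.prod_insert hv₁, map_mul, map_mul, mul_apply_eq_comp, ih, map_smul, hone, smul_smul,
        mul_comm]
  have h := key Finset.univ
  rwa [Finset.univ_prod_mulSingle] at h

/-- **§2′ The same through `ContRepresentation.restrict`**: `((rightRegular ν).restrict k) z [θ_{h_β ⊗ Φ_f}] = c(z) • [θ_{h_β ⊗ Φ_f}]`.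
[cite: KonnoKonno2007, Thm. 5.4] [cite: BorelJacquet1979, §4.6] -/
theorem restrict_rightRegular_apply_thetaClass_follandHermite_of_torusPin
    {τ : InfinitePlace L → ℤ} (hτ : (toHeckeCharacter L μ).HasUnitaryArchType τ 0) (hodd : ∀ w, Odd (τ w))
    (β : (Fin n' × {v : InfinitePlace (↥(maximalRealSubfield L)) // v.IsReal}) →₀ ℕ) (Φf : FinSB (↥(maximalRealSubfield L)) (Fin n'))
    (k : (({v : InfinitePlace (↥(maximalRealSubfield L)) // v.IsReal}) → Fin N → Circle) →*
      (adelicGroupData (↥(maximalRealSubfield L)) L (IsCMField.complexConj L) N H).Adelic)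
    (hk : ∀ (v : {v : InfinitePlace (↥(maximalRealSubfield L)) // v.IsReal}) (x : Fin N → Circle),
      ιA (k (Pi.mulSingle v x)) = UnitaryGroup.adelicSingle (↥(maximalRealSubfield L)) L (IsCMField.complexConj L) N (Matrix.diagonal dV)
        (IsCMField.complexConj_ne_one L) (complexConj_smul_infinitePlace L) (cmPlaceOver L v)
        ⟨circleDiagonal N x, circleDiagonal_mem_archLocal_diagonal L N dV (cmPlaceOver L v) x⟩)
    (z : ({v : InfinitePlace (↥(maximalRealSubfield L)) // v.IsReal}) → Fin N → Circle) :
    (((adelicGroupData (↥(maximalRealSubfield L)) L (IsCMField.complexConj L) N H).rightRegular ν).restrict k) z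
        (MemLp.toLp _ (memLp_toQuotFun_lineThetaLift L N H e₁ dV hdV hdV0 ιA hιA μ hμ a hρ μW
          (piSchwartzBruhatEquiv (↥(maximalRealSubfield L)) (Fin n')
            (follandHermite (frameV L e₁ dV hdV hdV0 (lineW L (TW (Fp L) a)) (complexConj_lineW L (TW (Fp L) a))
              (lineW_ne_zero L (TW (Fp L) a) (isUnit_det_TW (Fp L) a))) β ⊗ₜ Φf)) f ν 2)) =
      (∏ v : {v : InfinitePlace (↥(maximalRealSubfield L)) // v.IsReal}, ∏ p : Fin N, (((z v p : Circle) : ℂ)) ^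
        (if 0 < signVec (cmPlaceOver L) (cmGramEntry L e₁ dV hdV (lineW L (TW (Fp L) a)) (complexConj_lineW L (TW (Fp L) a))) (imagUnit L) v (e₁ (p, 0))
          then (τ (cmPlaceOver L v).1 + 1) / 2 + β (e₁ (p, 0), v)
          else (τ (cmPlaceOver L v).1 + 1) / 2 - 1 - β (e₁ (p, 0), v))) •
        (MemLp.toLp _ (memLp_toQuotFun_lineThetaLift L N H e₁ dV hdV hdV0 ιA hιA μ hμ a hρ μW
          (piSchwartzBruhatEquiv (↥(maximalRealSubfield L)) (Fin n')
            (follandHermite (frameV L e₁ dV hdV hdV0 (lineW L (TW (Fp L) a)) (complexConj_lineW L (TW (Fp L) a))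
              (lineW_ne_zero L (TW (Fp L) a) (isUnit_det_TW (Fp L) a))) β ⊗ₜ Φf)) f ν 2)) := by
  rw [ContRepresentation.restrict_apply]
  exact rightRegular_apply_thetaClass_follandHermite_of_torusPin L N H e₁ dV hdV hdV0 ιA hιA μ hμ a hρ μW f ν hτ hodd β Φf k hk z

/-! ## §3 The character projectors of the full torus on Hermite theta classes (★ p850551) -/

/-- **§3 (γ∞1) The full-torus projector of the EIGEN-type FIXES the Hermite theta class**: for a one-dimensional continuous unitary irreducible `κ` of
`T_∞ = ∏_{v real} (S¹)^N` with `κ z 1 = c(z)`, `Schur.charProj μT κ ((rightRegular ν).restrict k) [θ_{h_β ⊗ Φ_f}] = [θ_{h_β ⊗ Φ_f}]` (★ p850551 + §2).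
[cite: BrockerTomDieck1985, III (5.10)] [cite: KonnoKonno2007, Thm. 5.4] -/
theorem charProj_thetaClass_follandHermite_eq_self_of_torusPin
    {τ : InfinitePlace L → ℤ} (hτ : (toHeckeCharacter L μ).HasUnitaryArchType τ 0) (hodd : ∀ w, Odd (τ w))
    (β : (Fin n' × {v : InfinitePlace (↥(maximalRealSubfield L)) // v.IsReal}) →₀ ℕ) (Φf : FinSB (↥(maximalRealSubfield L)) (Fin n'))
    (k : (({v : InfinitePlace (↥(maximalRealSubfield L)) // v.IsReal}) → Fin N → Circle) →*
      (adelicGroupData (↥(maximalRealSubfield L)) L (IsCMField.complexConj L) N H).Adelic)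
    (hk : ∀ (v : {v : InfinitePlace (↥(maximalRealSubfield L)) // v.IsReal}) (x : Fin N → Circle),
      ιA (k (Pi.mulSingle v x)) = UnitaryGroup.adelicSingle (↥(maximalRealSubfield L)) L (IsCMField.complexConj L) N (Matrix.diagonal dV)
        (IsCMField.complexConj_ne_one L) (complexConj_smul_infinitePlace L) (cmPlaceOver L v)
        ⟨circleDiagonal N x, circleDiagonal_mem_archLocal_diagonal L N dV (cmPlaceOver L v) x⟩)
    [MeasurableSpace (({v : InfinitePlace (↥(maximalRealSubfield L)) // v.IsReal}) → Fin N → Circle)]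
    [BorelSpace (({v : InfinitePlace (↥(maximalRealSubfield L)) // v.IsReal}) → Fin N → Circle)]
    (μT : Measure (({v : InfinitePlace (↥(maximalRealSubfield L)) // v.IsReal}) → Fin N → Circle)) [IsProbabilityMeasure μT] [μT.IsMulLeftInvariant]
    {κ : ContRepresentation ℂ (({v : InfinitePlace (↥(maximalRealSubfield L)) // v.IsReal}) → Fin N → Circle) ℂ}
    (hκ : Continuous (κ : (({v : InfinitePlace (↥(maximalRealSubfield L)) // v.IsReal}) → Fin N → Circle) → ℂ →L[ℂ] ℂ)) [κ.toRepresentation.IsIrreducible]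
    (hκu : ∀ (g : ({v : InfinitePlace (↥(maximalRealSubfield L)) // v.IsReal}) → Fin N → Circle) (x y : ℂ), ⟪κ g x, κ g y⟫_ℂ = ⟪x, y⟫_ℂ)
    (hκc : ∀ z, κ z 1 = (∏ v : {v : InfinitePlace (↥(maximalRealSubfield L)) // v.IsReal}, ∏ p : Fin N, (((z v p : Circle) : ℂ)) ^
        (if 0 < signVec (cmPlaceOver L) (cmGramEntry L e₁ dV hdV (lineW L (TW (Fp L) a)) (complexConj_lineW L (TW (Fp L) a))) (imagUnit L) v (e₁ (p, 0))
          then (τ (cmPlaceOver L v).1 + 1) / 2 + β (e₁ (p, 0), v)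
          else (τ (cmPlaceOver L v).1 + 1) / 2 - 1 - β (e₁ (p, 0), v)))) :
    Schur.charProj μT κ (((adelicGroupData (↥(maximalRealSubfield L)) L (IsCMField.complexConj L) N H).rightRegular ν).restrict k)
        (MemLp.toLp _ (memLp_toQuotFun_lineThetaLift L N H e₁ dV hdV hdV0 ιA hιA μ hμ a hρ μW
          (piSchwartzBruhatEquiv (↥(maximalRealSubfield L)) (Fin n')
            (follandHermite (frameV L e₁ dV hdV hdV0 (lineW L (TW (Fp L) a)) (complexConj_lineW L (TW (Fp L) a))
              (lineW_ne_zero L (TW (Fp L) a) (isUnit_det_TW (Fp L) a))) β ⊗ₜ Φf)) f ν 2)) =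
      (MemLp.toLp _ (memLp_toQuotFun_lineThetaLift L N H e₁ dV hdV hdV0 ιA hιA μ hμ a hρ μW
          (piSchwartzBruhatEquiv (↥(maximalRealSubfield L)) (Fin n')
            (follandHermite (frameV L e₁ dV hdV hdV0 (lineW L (TW (Fp L) a)) (complexConj_lineW L (TW (Fp L) a))
              (lineW_ne_zero L (TW (Fp L) a) (isUnit_det_TW (Fp L) a))) β ⊗ₜ Φf)) f ν 2)) :=
  Schur.charProj_apply_of_forall_apply_eq_smul μT hκ hκu _ fun z => by
    rw [hκc z]
    exact restrict_rightRegular_apply_thetaClass_follandHermite_of_torusPin L N H e₁ dV hdV hdV0 ιA hιA μ hμ a hρ μW f ν hτ hodd β Φf k hk z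

/-- **§3 (γ∞2) The full-torus projector of ANY OTHER type KILLS the Hermite theta class**: for one-dimensional continuous `κ ≇ σ` (`κ` unitary) with
`σ z 1 = c(z)`, `Schur.charProj μT κ ((rightRegular ν).restrict k) [θ_{h_β ⊗ Φ_f}] = 0` (★ p850551 + §2). [cite: BrockerTomDieck1985, III (5.10); II (4.6)]
[cite: KonnoKonno2007, Thm. 5.4] -/
theorem charProj_thetaClass_follandHermite_eq_zero_of_torusPin
    {τ : InfinitePlace L → ℤ} (hτ : (toHeckeCharacter L μ).HasUnitaryArchType τ 0) (hodd : ∀ w, Odd (τ w))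
    (β : (Fin n' × {v : InfinitePlace (↥(maximalRealSubfield L)) // v.IsReal}) →₀ ℕ) (Φf : FinSB (↥(maximalRealSubfield L)) (Fin n'))
    (k : (({v : InfinitePlace (↥(maximalRealSubfield L)) // v.IsReal}) → Fin N → Circle) →*
      (adelicGroupData (↥(maximalRealSubfield L)) L (IsCMField.complexConj L) N H).Adelic)
    (hk : ∀ (v : {v : InfinitePlace (↥(maximalRealSubfield L)) // v.IsReal}) (x : Fin N → Circle),
      ιA (k (Pi.mulSingle v x)) = UnitaryGroup.adelicSingle (↥(maximalRealSubfield L)) L (IsCMField.complexConj L) N (Matrix.diagonal dV)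
        (IsCMField.complexConj_ne_one L) (complexConj_smul_infinitePlace L) (cmPlaceOver L v)
        ⟨circleDiagonal N x, circleDiagonal_mem_archLocal_diagonal L N dV (cmPlaceOver L v) x⟩)
    [MeasurableSpace (({v : InfinitePlace (↥(maximalRealSubfield L)) // v.IsReal}) → Fin N → Circle)]
    [BorelSpace (({v : InfinitePlace (↥(maximalRealSubfield L)) // v.IsReal}) → Fin N → Circle)]
    (μT : Measure (({v : InfinitePlace (↥(maximalRealSubfield L)) // v.IsReal}) → Fin N → Circle)) [IsProbabilityMeasure μT] [μT.IsMulLeftInvariant]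
    {κ σ : ContRepresentation ℂ (({v : InfinitePlace (↥(maximalRealSubfield L)) // v.IsReal}) → Fin N → Circle) ℂ}
    (hκ : Continuous (κ : (({v : InfinitePlace (↥(maximalRealSubfield L)) // v.IsReal}) → Fin N → Circle) → ℂ →L[ℂ] ℂ))
    (hσ : Continuous (σ : (({v : InfinitePlace (↥(maximalRealSubfield L)) // v.IsReal}) → Fin N → Circle) → ℂ →L[ℂ] ℂ))
    [κ.toRepresentation.IsIrreducible] [σ.toRepresentation.IsIrreducible]
    (hne : IsEmpty (κ.toRepresentation.Equiv σ.toRepresentation))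
    (hκu : ∀ (g : ({v : InfinitePlace (↥(maximalRealSubfield L)) // v.IsReal}) → Fin N → Circle) (x y : ℂ), ⟪κ g x, κ g y⟫_ℂ = ⟪x, y⟫_ℂ)
    (hσc : ∀ z, σ z 1 = (∏ v : {v : InfinitePlace (↥(maximalRealSubfield L)) // v.IsReal}, ∏ p : Fin N, (((z v p : Circle) : ℂ)) ^
        (if 0 < signVec (cmPlaceOver L) (cmGramEntry L e₁ dV hdV (lineW L (TW (Fp L) a)) (complexConj_lineW L (TW (Fp L) a))) (imagUnit L) v (e₁ (p, 0))
          then (τ (cmPlaceOver L v).1 + 1) / 2 + β (e₁ (p, 0), v)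
          else (τ (cmPlaceOver L v).1 + 1) / 2 - 1 - β (e₁ (p, 0), v)))) :
    Schur.charProj μT κ (((adelicGroupData (↥(maximalRealSubfield L)) L (IsCMField.complexConj L) N H).rightRegular ν).restrict k)
        (MemLp.toLp _ (memLp_toQuotFun_lineThetaLift L N H e₁ dV hdV hdV0 ιA hιA μ hμ a hρ μW
          (piSchwartzBruhatEquiv (↥(maximalRealSubfield L)) (Fin n')
            (follandHermite (frameV L e₁ dV hdV hdV0 (lineW L (TW (Fp L) a)) (complexConj_lineW L (TW (Fp L) a))
              (lineW_ne_zero L (TW (Fp L) a) (isUnit_det_TW (Fp L) a))) β ⊗ₜ Φf)) f ν 2)) = 0 :=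
  Schur.charProj_apply_eq_zero_of_forall_apply_eq_smul μT hκ hσ hne hκu _ fun z => by
    rw [hσc z]
    exact restrict_rightRegular_apply_thetaClass_follandHermite_of_torusPin L N H e₁ dV hdV hdV0 ιA hιA μ hμ a hρ μW f ν hτ hodd β Φf k hk z

end Eigen

end Summit.HodgeConjecture.HodgeConjecture.Cruxes.HLiu418.F0LD1ArchTorusHom

end
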